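import Summits.HodgeConjecture.HodgeConjecture.Theorems.R90S9HlocRecordSCDOfHQS        -- ★ p865005 (R90-IF-p03 g4): `aPacketsOfRecordDisjointAt_recordSCD_of_hQS_of_carrierLaws` (row 25 composition over `hdict hα hγ`, `hloc` paid)
import Summits.HodgeConjecture.HodgeConjecture.Theorems.R90S9HdictOfSlotsInFibre        -- ★ p865130 (R90-IF-p03 g4): `hdict_recordSCD_of_slotsInFibre`, `carrierLaw_nonsc_of_fibreLawSingleton`, `carrierLaw_sc_of_fibreLawSingleton`
import HarnessLib

/-!
# R90-TF · S9 «InnerForm-13.3.6 (c)» — ROW 25 (`sock_S9_aPacketsDisjointNonsplit_cm`) FROM S4's PER-PLACE FIBRE LAWS (L25b): THE S9 GLUE, ★ END TO END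

Cell `hodgecm-mathlib`, crux H413 (`stmt-HodgeConjecture-24833`, lane `--supports … --as helper`), route of record `HCCMUnconditional` (no route verbs;
count-neutral).  Programme R90-TF (HUMAN RULING «R90-TF SLAB — MAX PUSH»; brief `director/R90-BRIEF.v2.md` 1f40d54518340a35), section S9 = InnerForm-13.3.6 (c)
(base `R90-IF`); seat R90-IF-p05 (g2); dealer R90-IF-plan (g3) DEAL (L25) 2026-09-05T04:06:39Z «ROW-25 LETTER GROUP IN S4's CURRENCY + PAY CERT» and its ★ follow-up
(L25b) (HOME cert `R90/R90-IF-p05/g2/CERT-L25-row25-of-S4letters.lean` c62166db9a32d90b, whose §2 this file re-states over ★ p865005's abstract binders).  THEOREMS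
ONLY: no `def`, no instance, no notation, no named fact, no `sorry`; imports ★ only; X-generic (no `Lines`, no S4 module; `keys` generic).  HONEST LABEL: HC_CM is
proved only modulo the 7 printed citations (2 remaining named inputs: hLiu418 = stmt-HodgeConjecture-24832, h413 = stmt-HodgeConjecture-24833) — until rung 0 closes.
A glue lemma: it pays no socket by itself (payer-map row 25 waits on S4's per-place letters (α′)(γ′)(J1)(J2), A ED. 6).

## Statement [Rogawski1990, §13.1 Prop. 13.1.2 (c), Prop. 13.1.3 (d), Prop. 13.1.4 pp. 198–199; §12.2 (2) pp. 173–174]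
`aPacketsOfRecordDisjointAt_recordSCD_of_fibreLawsAt`: at the pinned SCD record `Ξ₀ := xiPacketFamilyOfRecordSCD … keys (hSCD_of_cmCharIdentityPackageTestSigned … hQS)`
(binders of ★ p865005 through `hex`, plus `hμω`), the hypothesis is S4's LETTER READ PER NON-SPLIT PLACE `v` (JQ-S9-S4-7 v2, S4's LOCAL currency): THERE EXIST a frame
`ᵗσT₀ · H_v · T₀ = a₀ · Φ₃` and fibres `fib χ ⊆ Irr(U(Φ₃)(L⁺_v))` of the one-dimensional carriers `{⟦ℂ_χ⟧}`, `χ` a LOCAL character of `H_v`, with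
(α′) two fibres sharing a NON-supercuspidal class have equal carriers `{⟦ℂ_χ⟧} = {⟦ℂ_χ′⟧}` (LC-OVERLAP + LC-XIFIB), (γ′) the supercuspidal twin (LC-ADISJ-SC),
(J1) Keys' non-tempered label `πⁿ(ξ_v) = (keys ξ v hns).1.2` lies in `fib ξ_v` (Prop. 13.1.4), (J2) every supercuspidal `πˢ ≠ πⁿ(ξ_v) ∘ e₀⁻¹` completing the SIGNED
identity (13.1.4) on test functions at the inner form's data `(Δ_v, m_H, m_G, ν_G, ν_H)` (sign `ε_v = ω(a₀)`) pulls back along `e₀ := cmDatumLocalCongr L v T₀ ha₀ h₀`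
INTO `fib ξ_v`.  Conclusion: `∀ v, APacketsOfRecordDisjointAt L H Ξ₀ v` — ★ p865005's conclusion, the TYPE of FILE B's row-25 socket body at every place.
PROOF: §1 globalises the per-place `∃` by choice (junk frame `1`, junk fibres `∅` at the split places — never read); §2 feeds ★ p865005 with S9's pins
`supp v ξ := {a | ∀ hns, comap (e₀ v hns) a ∈ fib v (ξ_v)}`, `IsSC := IsSupercuspidal`, the dictionary by ★ p865130 `hdict_recordSCD_of_slotsInFibre` — (J2) instantiated
at the record's own signed partner `((hQS ξ).1 v hns (T₀ v) …).πs` through ★ `.πs_isSupercuspidal ∕ .πs_ne ∕ .charIdentityAtTestSigned_πs` — and the laws through ★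
`carrierLaw_{nonsc,sc}_of_fibreLawSingleton`.

## References
* [Rogawski1990] J. D. Rogawski, *Automorphic Representations of Unitary Groups in Three Variables*, Ann. of Math. Stud. 123 (1990): §13.1 Prop. 13.1.2 (c),
  Prop. 13.1.3 (d), Prop. 13.1.4 pp. 198–199, p. 199 ¶2–3; §12.2 (2) pp. 173–174; §12.1 p. 171; §14.2 p. 232; §4.9 p. 55; §14.6 p. 242.
* [BushnellHenniart2006] C. J. Bushnell, G. Henniart, *The Local Langlands Conjecture for GL(2)*, Grundlehren 335 (2006): §1.1.
-/

set_option autoImplicit false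
-- the mandated namespace repeats `HodgeConjecture.HodgeConjecture`, as in every `Theorems/*.lean` of this sub-problem
set_option linter.dupNamespace false

noncomputable section

open NumberField IsDedekindDomain MeasureTheory
open scoped Matrix
open Literature.NumberTheory Literature.NumberTheory.Automorphic Literature.NumberTheory.Automorphic.UnitaryGroup
open Literature.NumberTheory.Automorphic.IdeleClassGroup Literature.NumberTheory.GaloisRepresentations Literature.NumberTheory.Rogawski1990
open Summit.HodgeConjecture.HodgeConjecture.Cruxes.H413
open Summit.HodgeConjecture.HodgeConjecture.Cruxes.H413.F0P3XiPacketFamilyOfRecordSCD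

namespace Summit.HodgeConjecture.HodgeConjecture.R90.S9

/-! ## §1 Generic: a frame-and-fibres witness given under a side condition becomes a TOTAL witness (junk off the condition) -/

/-- **Globalisation of a conditional existential witness.**  If under a condition `NS` (the place is non-split) there exist a frame `T`, a multiplier `a` with
`U a` (a unit), a congruence certificate `E T a`, fibres `f`, and a property `P`, then — choosing the junk `(T₁, a₁, u₁, f₁)` off `NS` — there exist `T a u f` OUTRIGHT such
that under `NS` a certificate `E T a` and the property hold.  Pure logic (excluded middle); used to feed total families `T₀ a₀ ha₀ fib : ∀ v, …` to ★ p865130.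
[cite: Rogawski1990, §14.2 p. 232] [folklore] -/
theorem exists_total_of_exists_under {NS : Prop} {A B F : Type*} {U : B → Prop} {E : A → B → Prop}
    {P : NS → ∀ (T : A) (a : B), U a → E T a → F → Prop} (T₁ : A) (a₁ : B) (u₁ : U a₁) (f₁ : F)
    (h : ∀ hns : NS, ∃ (T : A) (a : B) (u : U a) (e : E T a) (f : F), P hns T a u e f) :
    ∃ (T : A) (a : B) (u : U a) (f : F), ∀ hns : NS, ∃ e : E T a, P hns T a u e f := by
  by_cases hv : NS
  · obtain ⟨T, a, u, e, f, hP⟩ := h hv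
    exact ⟨T, a, u, f, fun _ => ⟨e, hP⟩⟩
  · exact ⟨T₁, a₁, u₁, f₁, fun hns => absurd hns hv⟩

/-! ## §2 Row 25 at the pinned SCD record from S4's per-place fibre laws -/

section FibreLaws

variable (L : Type) [Field L] [NumberField L] [IsCMField L] (H : Matrix (Fin 3) (Fin 3) L)

open scoped Classical in
set_option synthInstance.maxHeartbeats 400000 in
set_option maxHeartbeats 8000000 in
/-- **«IN AT MOST ONE» FOR THE A-PACKETS OF THE PINNED SCD RECORD, FROM S4's PER-PLACE FIBRE LAWS (α′)(γ′)(J1)(J2) ALONE** (plus `hQS`, (H₇) `hex`, `hμω`).  At each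
non-split `v` the letter gives a frame `(T₀, a₀)` — `e₀ := cmDatumLocalCongr L v T₀ ha₀ h₀ : U(Φ₃)(L⁺_v) ≃ₜ* U(H)(L⁺_v)` — and fibres `fib χ ⊆ Irr(U(Φ₃)(L⁺_v))` of the
carriers `{⟦ℂ_χ⟧}` indexed by the local characters `χ` of `H_v`, with: (α′) a NON-supercuspidal class common to `fib χ`, `fib χ′` forces `{⟦ℂ_χ⟧} = {⟦ℂ_χ′⟧}` (§12.2 (2):
`πⁿ(ξ_v)` determines `ξ_v`; LC-OVERLAP + LC-XIFIB); (γ′) the supercuspidal twin (Prop. 13.1.3 (d); LC-ADISJ-SC); (J1) `(keys ξ v hns).1.2 ∈ fib (ξ_v)` (Prop. 13.1.4: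
`πⁿ(ξ) ∈ Π(ξ)`); (J2) every supercuspidal `πˢ ≠ πⁿ(ξ_v) ∘ e₀⁻¹` with `⟨πⁿ(ξ_v) ∘ e₀⁻¹, πˢ⟩` satisfying the SIGNED (13.1.4) on test functions at `(Δ_v, m_H, m_G, ν_G, ν_H)`,
sign `ε_v(H) = ω(a₀)`, has `πˢ ∘ e₀ ∈ fib (ξ_v)` (Prop. 13.1.4: `πˢ(ξ) ∈ Π(ξ)`, transported).  Conclusion: `∀ v, APacketsOfRecordDisjointAt L H Ξ₀ v` at
`Ξ₀ := xiPacketFamilyOfRecordSCD … keys (hSCD_of_cmCharIdentityPackageTestSigned … hQS)` (★ p865005's conclusion; split places inside ★ p864777).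
[cite: Rogawski1990, §13.1 Prop. 13.1.2 (c), Prop. 13.1.3 (d), Prop. 13.1.4 pp. 198–199, p. 199 l. 14–18; §12.2 (2) pp. 173–174; §12.1 p. 171] [cite: BushnellHenniart2006, §1.1] -/
theorem aPacketsOfRecordDisjointAt_recordSCD_of_fibreLawsAt (hH : (H.map (cmConjRingHom L))ᵀ = H) (hHd : IsUnit H.det)
    (μω : HeckeCharacter L) (hμu : μω.IsUnitary)
    (hμω : ∀ x : Literature.NumberTheory.GaloisRepresentations.ideleGroup ↥(maximalRealSubfield L),
      μω (AdeleRing.ideleBaseChange ↥(maximalRealSubfield L) L x) = quadraticHeckeCharCM L x)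
    [∀ v : HeightOneSpectrum (𝓞 ↥(maximalRealSubfield L)), MeasurableSpace ((cmDatum L 3 H).Local v)]
    [∀ v : HeightOneSpectrum (𝓞 ↥(maximalRealSubfield L)), BorelSpace ((cmDatum L 3 H).Local v)]
    [∀ v : HeightOneSpectrum (𝓞 ↥(maximalRealSubfield L)),
      MeasurableSpace ((cmDatum L 2 (Matrix.of fun i j : Fin 2 => if i.val + j.val + 1 = 2 then (1 : L) else 0)).Local v ×
        (cmDatum L 1 (Matrix.of fun i j : Fin 1 => if i.val + j.val + 1 = 1 then (1 : L) else 0)).Local v)]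
    [∀ (v : HeightOneSpectrum (𝓞 ↥(maximalRealSubfield L)))
        (a : ((cmDatum L 2 (Matrix.of fun i j : Fin 2 => if i.val + j.val + 1 = 2 then (1 : L) else 0)).Local v ×
        (cmDatum L 1 (Matrix.of fun i j : Fin 1 => if i.val + j.val + 1 = 1 then (1 : L) else 0)).Local v)),
      MeasurableSpace (((cmDatum L 2 (Matrix.of fun i j : Fin 2 => if i.val + j.val + 1 = 2 then (1 : L) else 0)).Local v ×
        (cmDatum L 1 (Matrix.of fun i j : Fin 1 => if i.val + j.val + 1 = 1 then (1 : L) else 0)).Local v) ⧸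
        Subgroup.centralizer ({a} : Set ((cmDatum L 2 (Matrix.of fun i j : Fin 2 => if i.val + j.val + 1 = 2 then (1 : L) else 0)).Local v ×
        (cmDatum L 1 (Matrix.of fun i j : Fin 1 => if i.val + j.val + 1 = 1 then (1 : L) else 0)).Local v)))]
    [∀ (v : HeightOneSpectrum (𝓞 ↥(maximalRealSubfield L))) (γ : (cmDatum L 3 H).Local v),
      MeasurableSpace ((cmDatum L 3 H).Local v ⧸ Subgroup.centralizer ({γ} : Set ((cmDatum L 3 H).Local v)))]
    [∀ v : HeightOneSpectrum (𝓞 ↥(maximalRealSubfield L)), MeasurableSpace (Gqs L v ⧸ Subgroup.center (Gqs L v))]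
    [∀ v : HeightOneSpectrum (𝓞 ↥(maximalRealSubfield L)), BorelSpace (Gqs L v ⧸ Subgroup.center (Gqs L v))]
    {Δ : ∀ v : HeightOneSpectrum (𝓞 ↥(maximalRealSubfield L)), LocalTransferFactor L H v}
    {mH : ∀ v : HeightOneSpectrum (𝓞 ↥(maximalRealSubfield L)),
      OrbitalMeasureFamily ((cmDatum L 2 (Matrix.of fun i j : Fin 2 => if i.val + j.val + 1 = 2 then (1 : L) else 0)).Local v ×
        (cmDatum L 1 (Matrix.of fun i j : Fin 1 => if i.val + j.val + 1 = 1 then (1 : L) else 0)).Local v)}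
    {mG : ∀ v : HeightOneSpectrum (𝓞 ↥(maximalRealSubfield L)), OrbitalMeasureFamily ((cmDatum L 3 H).Local v)}
    {νH : ∀ v : HeightOneSpectrum (𝓞 ↥(maximalRealSubfield L)),
      Measure ((cmDatum L 2 (Matrix.of fun i j : Fin 2 => if i.val + j.val + 1 = 2 then (1 : L) else 0)).Local v ×
        (cmDatum L 1 (Matrix.of fun i j : Fin 1 => if i.val + j.val + 1 = 1 then (1 : L) else 0)).Local v)}
    (νG : ∀ v : HeightOneSpectrum (𝓞 ↥(maximalRealSubfield L)), Measure ((cmDatum L 3 H).Local v))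
    [∀ v : HeightOneSpectrum (𝓞 ↥(maximalRealSubfield L)), (νG v).IsHaarMeasure]
    (μZ : ∀ v : HeightOneSpectrum (𝓞 ↥(maximalRealSubfield L)), Measure (Gqs L v ⧸ Subgroup.center (Gqs L v)))
    [∀ v : HeightOneSpectrum (𝓞 ↥(maximalRealSubfield L)), (μZ v).IsHaarMeasure]
    (keys : ∀ (ξ : OneDimAutRepH L) (v : HeightOneSpectrum (𝓞 ↥(maximalRealSubfield L))),
      (∀ w : PlacesOver L v, IsCMField.complexConj L • w.1 = w.1) →
        {p : IrrClass (Gqs L v) × IrrClass (Gqs L v) //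
          KeysCaseTwoLabels L v (μω.semilocalComponent L v) (torusLocalComponent L (IsCMField.complexConj L) v ξ.η)
            (torusLocalComponent L (IsCMField.complexConj L) v ξ.ψ) p.1 p.2 ∧
          p.1.IsSquareIntegrable (μZ v) ∧ ¬ p.2.IsSquareIntegrable (μZ v)})
    (hQS : CMCharIdentityPackageTestSigned L H hH hHd νH νG μω hμu Δ mH mG)
    (hex : ∀ v : HeightOneSpectrum (𝓞 ↥(maximalRealSubfield L)), (∀ w : PlacesOver L v, IsCMField.complexConj L • w.1 = w.1) →
      IsLocalDeltaTransferExists L H v (Δ v) (mH v) (mG v) IsLocSmooth IsLocSmooth)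
    -- S4's LETTER, READ PER NON-SPLIT PLACE (JQ-S9-S4-7 v2): a frame and fibres with (α′) (γ′) (J1) (J2)
    (hL : ∀ (v : HeightOneSpectrum (𝓞 ↥(maximalRealSubfield L))) (hns : ∀ w : PlacesOver L v, IsCMField.complexConj L • w.1 = w.1),
      ∃ (T₀ : GL (Fin 3) (LocalRing L v)) (a₀ : LocalRing L v) (ha₀ : IsUnit a₀)
        (h₀ : formCongr (conjLocal L (IsCMField.complexConj L) v) T₀ (H.map (algebraMap L (LocalRing L v))) =
          a₀ • (Matrix.of fun i j : Fin 3 => if i.val + j.val + 1 = 3 then (1 : L) else 0).map (algebraMap L (LocalRing L v)))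
        (fib : (((cmDatum L 2 (Matrix.of fun i j : Fin 2 => if i.val + j.val + 1 = 2 then (1 : L) else 0)).Local v ×
        (cmDatum L 1 (Matrix.of fun i j : Fin 1 => if i.val + j.val + 1 = 1 then (1 : L) else 0)).Local v) →* ℂˣ) → Set (IrrClass (Gqs L v))),
        -- (α′) LC-OVERLAP + LC-XIFIB in the singleton-carrier currency
        (∀ χ χ'
          (hχ : IsOpen ((χ.ker : Subgroup ((cmDatum L 2 (Matrix.of fun i j : Fin 2 => if i.val + j.val + 1 = 2 then (1 : L) else 0)).Local v ×
        (cmDatum L 1 (Matrix.of fun i j : Fin 1 => if i.val + j.val + 1 = 1 then (1 : L) else 0)).Local v)) :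
            Set ((cmDatum L 2 (Matrix.of fun i j : Fin 2 => if i.val + j.val + 1 = 2 then (1 : L) else 0)).Local v ×
        (cmDatum L 1 (Matrix.of fun i j : Fin 1 => if i.val + j.val + 1 = 1 then (1 : L) else 0)).Local v)))
          (hχ' : IsOpen ((χ'.ker : Subgroup ((cmDatum L 2 (Matrix.of fun i j : Fin 2 => if i.val + j.val + 1 = 2 then (1 : L) else 0)).Local v ×
        (cmDatum L 1 (Matrix.of fun i j : Fin 1 => if i.val + j.val + 1 = 1 then (1 : L) else 0)).Local v)) :
            Set ((cmDatum L 2 (Matrix.of fun i j : Fin 2 => if i.val + j.val + 1 = 2 then (1 : L) else 0)).Local v ×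
        (cmDatum L 1 (Matrix.of fun i j : Fin 1 => if i.val + j.val + 1 = 1 then (1 : L) else 0)).Local v))) π,
          π ∈ fib χ → π ∈ fib χ' → ¬ π.IsSupercuspidal →
            ({IrrClass.mk (SmoothIrrep.ofChar χ hχ)} : Finset (IrrClass ((cmDatum L 2 (Matrix.of fun i j : Fin 2 => if i.val + j.val + 1 = 2 then (1 : L) else 0)).Local v ×
        (cmDatum L 1 (Matrix.of fun i j : Fin 1 => if i.val + j.val + 1 = 1 then (1 : L) else 0)).Local v))) =
              {IrrClass.mk (SmoothIrrep.ofChar χ' hχ')}) ∧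
        -- (γ′) LC-ADISJ-SC, the supercuspidal twin
        (∀ χ χ'
          (hχ : IsOpen ((χ.ker : Subgroup ((cmDatum L 2 (Matrix.of fun i j : Fin 2 => if i.val + j.val + 1 = 2 then (1 : L) else 0)).Local v ×
        (cmDatum L 1 (Matrix.of fun i j : Fin 1 => if i.val + j.val + 1 = 1 then (1 : L) else 0)).Local v)) :
            Set ((cmDatum L 2 (Matrix.of fun i j : Fin 2 => if i.val + j.val + 1 = 2 then (1 : L) else 0)).Local v ×
        (cmDatum L 1 (Matrix.of fun i j : Fin 1 => if i.val + j.val + 1 = 1 then (1 : L) else 0)).Local v)))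
          (hχ' : IsOpen ((χ'.ker : Subgroup ((cmDatum L 2 (Matrix.of fun i j : Fin 2 => if i.val + j.val + 1 = 2 then (1 : L) else 0)).Local v ×
        (cmDatum L 1 (Matrix.of fun i j : Fin 1 => if i.val + j.val + 1 = 1 then (1 : L) else 0)).Local v)) :
            Set ((cmDatum L 2 (Matrix.of fun i j : Fin 2 => if i.val + j.val + 1 = 2 then (1 : L) else 0)).Local v ×
        (cmDatum L 1 (Matrix.of fun i j : Fin 1 => if i.val + j.val + 1 = 1 then (1 : L) else 0)).Local v))) π,
          π ∈ fib χ → π ∈ fib χ' → π.IsSupercuspidal →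
            ({IrrClass.mk (SmoothIrrep.ofChar χ hχ)} : Finset (IrrClass ((cmDatum L 2 (Matrix.of fun i j : Fin 2 => if i.val + j.val + 1 = 2 then (1 : L) else 0)).Local v ×
        (cmDatum L 1 (Matrix.of fun i j : Fin 1 => if i.val + j.val + 1 = 1 then (1 : L) else 0)).Local v))) =
              {IrrClass.mk (SmoothIrrep.ofChar χ' hχ')}) ∧
        -- (J1) Keys' non-tempered label `πⁿ(ξ_v)` lies in the fibre of `ℂ_{ξ_v}`
        (∀ ξ : OneDimAutRepH L, (keys ξ v hns).1.2 ∈ fib (ξ.xiLocalChar v)) ∧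
        -- (J2) every SIGNED supercuspidal completion of `πⁿ(ξ_v) ∘ e₀⁻¹` at the inner form's data pulls back into the fibre of `ℂ_{ξ_v}`
        (∀ (ξ : OneDimAutRepH L) (πs : IrrClass ((cmDatum L 3 H).Local v)), πs.IsSupercuspidal →
          πs ≠ IrrClass.comap (cmDatumLocalCongr L v T₀ ha₀ h₀).symm (keys ξ v hns).1.2 →
          (⟨IrrClass.comap (cmDatumLocalCongr L v T₀ ha₀ h₀).symm (keys ξ v hns).1.2, some πs⟩ : CMLocalAPacket L H v).CharIdentityAtTest L H v
            (fun c f => (if ∃ z : LocalRing L v, IsUnit z ∧ a₀ = z * conjLocal L (IsCMField.complexConj L) v z then (1 : ℂ) else -1) *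
              c.smoothTrace (νG v) f)
            (ξ.xiLocalChar v) (νH v) (Δ v) (mH v) (mG v) →
          IrrClass.comap (cmDatumLocalCongr L v T₀ ha₀ h₀) πs ∈ fib (ξ.xiLocalChar v))) :
    ∀ v : HeightOneSpectrum (𝓞 ↥(maximalRealSubfield L)),
      InnerFormSec146.APacketsOfRecordDisjointAt L H
        (xiPacketFamilyOfRecordSCD L H hH hHd μω hμu μZ keys (hSCD_of_cmCharIdentityPackageTestSigned L H hH hHd μω hμu Δ mH mG νG νH μZ hQS)) v := by
  -- §1: globalise the per-place witnesses (junk `1 ∕ 1 ∕ ∅` at the split places, never read)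
  have key := fun v : HeightOneSpectrum (𝓞 ↥(maximalRealSubfield L)) =>
    exists_total_of_exists_under (1 : GL (Fin 3) (LocalRing L v)) (1 : LocalRing L v) isUnit_one
      (fun _ : ((cmDatum L 2 (Matrix.of fun i j : Fin 2 => if i.val + j.val + 1 = 2 then (1 : L) else 0)).Local v ×
        (cmDatum L 1 (Matrix.of fun i j : Fin 1 => if i.val + j.val + 1 = 1 then (1 : L) else 0)).Local v) →* ℂˣ => (∅ : Set (IrrClass (Gqs L v)))) (hL v)
  choose T₀ a₀ ha₀ fib hrest using key
  choose h₀ hlaw using hrest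
  -- §2: ★ p865005 at S9's pins, dictionary by ★ p865130, laws by ★ `carrierLaw_*_of_fibreLawSingleton`
  exact aPacketsOfRecordDisjointAt_recordSCD_of_hQS_of_carrierLaws L H hH hHd μω hμu νG μZ keys hQS hex
    (fun v ξ => {a | ∀ hns, IrrClass.comap (cmDatumLocalCongr L v (T₀ v) (ha₀ v) (h₀ v hns)) a ∈ fib v (ξ.xiLocalChar v)})
    (fun v => IrrClass.IsSupercuspidal)
    (hdict_recordSCD_of_slotsInFibre L H hH hHd μω hμu hμω νG μZ keys hQS hex T₀ a₀ ha₀ h₀ fib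
      (fun v ξ => {a | ∀ hns, IrrClass.comap (cmDatumLocalCongr L v (T₀ v) (ha₀ v) (h₀ v hns)) a ∈ fib v (ξ.xiLocalChar v)})
      (fun v hns ξ a => Set.mem_setOf.trans ⟨fun h => h hns, fun h _ => h⟩)
      (fun ξ v hns => (hlaw v hns).2.2.1 ξ)
      (fun ξ v hns => (hlaw v hns).2.2.2 ξ _
        ((hQS ξ).1 v hns (T₀ v) (a₀ v) (ha₀ v) (h₀ v hns) (μZ v) (keys ξ v hns).1.1 (keys ξ v hns).1.2 (keys ξ v hns).2.1
          (keys ξ v hns).2.2.2).πs_isSupercuspidal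
        ((hQS ξ).1 v hns (T₀ v) (a₀ v) (ha₀ v) (h₀ v hns) (μZ v) (keys ξ v hns).1.1 (keys ξ v hns).1.2 (keys ξ v hns).2.1
          (keys ξ v hns).2.2.2).πs_ne
        ((hQS ξ).1 v hns (T₀ v) (a₀ v) (ha₀ v) (h₀ v hns) (μZ v) (keys ξ v hns).1.1 (keys ξ v hns).1.2 (keys ξ v hns).2.1
          (keys ξ v hns).2.2.2).charIdentityAtTestSigned_πs))
    (fun v hns ξ ξ' a ha ha' hn => carrierLaw_nonsc_of_fibreLawSingleton L H v (cmDatumLocalCongr L v (T₀ v) (ha₀ v) (h₀ v hns)) (fib v)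
      ((hlaw v hns).1) ξ ξ' a ⟨_, Set.mem_setOf.1 ha hns, IrrClass.comap_symm_comap _ a⟩ ⟨_, Set.mem_setOf.1 ha' hns, IrrClass.comap_symm_comap _ a⟩ hn)
    (fun v hns ξ ξ' a ha ha' hs => carrierLaw_sc_of_fibreLawSingleton L H v (cmDatumLocalCongr L v (T₀ v) (ha₀ v) (h₀ v hns)) (fib v)
      ((hlaw v hns).2.1) ξ ξ' a ⟨_, Set.mem_setOf.1 ha hns, IrrClass.comap_symm_comap _ a⟩ ⟨_, Set.mem_setOf.1 ha' hns, IrrClass.comap_symm_comap _ a⟩ hs)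

end FibreLaws

end Summit.HodgeConjecture.HodgeConjecture.R90.S9

end
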